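import Literature.MathematicalPhysics.QuantumFieldTheory.Balaban1983to89.B9Eq319QprimeTowerLipschitzL2
import Literature.MathematicalPhysics.QuantumFieldTheory.Balaban1983to89.B9Eq319QprimeLipschitzTwoBackgrounds

/-!
# `Balaban1983to89.B9Eq319QprimeTowerLipschitzL2TwoBackgrounds` — T. Bałaban, *Propagators for lattice gauge theories in a background field*, Commun.
# Math. Phys. **99** (1985) 389–434 [Balaban1985BackgroundPropagators] (3.19) p. 393 (the composite gauge-parameter averaging `Q′_k(U) = Q′(Ū^{k−1})⋯Q′(U)`),
# (3.11) p. 392, p. 403 («R(U), P(U) … extend analytically to the domain (3.37) and satisfy the same bounds»), (3.65) p. 403, (3.79)–(3.81) p. 406, with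
# [Balaban1985Averaging] (2)–(4) pp. 17–18: **THE TWO-FAMILY TOWER LETTER IN THE `ℓ²` CURRENCY, VOLUME-FREE —
# `√(Σ_y ‖(Q′_n(R)λ − Q′_n(R′)λ)(y)‖²) ≤ Π_{j<n}(1 + ρ(ε_j))·(Π_{j<n}(1 + ρ₂(ε_j,δ_j)) − 1)·(√(L^{−d}))^n·√(Σ_x ‖λ(x)‖²)`** for TWO level families of
# `ℂ`-linear bond transporters, both `ε_j`-close to the identity and `δ_j`-close to each other (`ρ(ε) = (1+ε)^{d(L−1)} − 1`, `ρ₂(ε,δ) = d(L−1)·δ·(1+ε)^{d(L−1)}`)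
# — the `ℓ²` telescoping of ne9-leaf-03's one-step two-background Hilbert letter (`B9Eq319QprimeLipschitzTwoBackgrounds.sum_norm_sq_QprimeLin_sub_QprimeLin_le`)
# along ne9-leaf-02's one-family `ℓ²` tower (`B9Eq319QprimeTowerLipschitzL2`): NO `(√c₀)⁻¹ = L^{kd∕2}`, NO volume, the number of levels ONLY in the products

statement-level skeleton of published theorems with citation tags; proofs where landed; nothing here is a claim about the Yang–Mills mass gap

PDF held: `paper:balaban1985-cmp99-background-propagators` (journal page = PDF page + 388), pp. 392–393, 396, 403, 406 — through the verbatim quotations of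
the supplier files `B9Eq319QprimeTowerLipschitzL2` (ne9-leaf-02 gen 64) and `B9Eq319QprimeLipschitzTwoBackgrounds` (ne9-leaf-03).

CITATION HEADER (lean-in-tree rule 2026-08-18).  Audit cell `pub-balaban`, sub-cell `t4`, NE9 crux team (2): LEAF PROVER 04
(`b2b-balaban-t4-ne9-formalise-leaf-04` gen 77), INTENT-1 (file 1 of 2; file 2 = `B9Eq319QprimeTowerLipschitzL2TwoBackgroundsChain`, the reading on the
NE9 chain's carrier).  WHY: the NE9 owner's g85∕g86 diagonal ladder (`R`-letter → form defect → Green → `H_{1,k}` → `𝔊_k`, all `∃ α₀ C` before every binder)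
compares ONE small background `U` with the FLAT one; NE9's two coupling histories produce TWO small backgrounds `U`, `V`, and the tree's two-background
ladder (`B9Eq315QTowerLipschitzTwoBackgrounds` → `B9Eq368RLipschitzTowerTwoBackgrounds` → … → `B11Eq174ChartContinuityTwoBackgrounds`) is `∃ C` AT A FIXED
LATTICE: its `ρ′_k(U,U′)` letter (`B9Eq315QTowerLipschitzTwoBackgrounds.norm_QprimeTowerW_sub_QprimeTowerW_le`) carries `(n+1)·K^{n+1}` and the sup ↔ `L²`
factor `(√c₀)⁻¹ = L^{kd∕2}`.  THIS FILE is the abstract `ℓ²` telescoping for the volume-free replacement; the chain reading (the `θ_Q(U,V)` letter of this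
lineage's `B9Eq325RLipschitzSqrtTower.norm_RofUk_sub_RofUk_le_sqrt`) is file 2.

THE PRINT (verbatim, as quoted by the suppliers).  (3.19) p. 393: *«(Q′λ)(y) = Σ_{x∈B(y)} L^{−d} R(U(Γ_{y,x}))λ(x) … Q′_k = Q′(Ū^{k−1})⋯Q′(U)»*;
p. 403 l. 27–28: *«These results imply that the operators R(U), P(U) = I − R(U) extend analytically to the domain (3.37) and satisfy the same bounds»*;
(3.65) p. 403: the perturbation `F′₂` of the averaging at nearby backgrounds.

WHAT IS PROVED (sorry-free; proof lane — 0 `def`, no `Prop` placeholder, no inequality of the papers asserted hypothesis-free; [folklore] `ℓ²` telescoping).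
* §0 Minkowski in `ℓ²` for finite families (private; as in leaf-02's file).
* §1 **`sqrt_sum_norm_sq_QprimeTower_le`** — ONE level family `ε_j`-close to the identity: `√Σ‖Q′_n(R)λ‖² ≤ Π_{j<n}(1+ρ(ε_j))·(√(L^{−d}))^n·√Σ‖λ‖²`
  (leaf-02's flat contraction `sqrt_sum_norm_sq_QprimeTower_flat_le` + deviation `sqrt_sum_norm_sq_QprimeTower_sub_id_le`, Minkowski);
  **`sqrt_sum_norm_sq_QprimeTower_sub_QprimeTower_le`** — TWO level families `R`, `R′`, both `ε_j`-close to the identity, `δ_j`-close to each other: the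
  displayed bound above.  Telescoping `Q′_{n+1}(R) − Q′_{n+1}(R′) = [Q′_n(R) − Q′_n(R′)]∘Q′(R_n) + Q′_n(R′)∘[Q′(R_n) − Q′(R′_n)]` (`QprimeTower_succ`
  definitionally; Minkowski); recursion `D_{n+1} ≤ D_n(1+ρ_n) + P_nρ₂,ₙ` closed by `D_n ≤ P_n(T_n − 1)`, `P_n = Π_{j<n}(1+ρ_j)`, `T_n = Π_{j<n}(1+ρ₂,ⱼ)`
  (because `ρ₂,ₙ ≤ (1+ρ_n)T_nρ₂,ₙ`).
MODEL ∕ DECLARED READINGS.  (M1) as `B9Eq319QprimeTowerLipschitzL2` §2: the tower of tori `T_{L^j m}` (`B9Eq315QTower.towerP`), ANY two level families of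
`ℂ`-linear bond transporters on a complex normed space `V`; the closeness letters `ε_j`, `δ_j` are hypotheses.  (M2) the coarse norm is the UNWEIGHTED `ℓ²`
over `T_m` stated as `√Σ_y‖·‖²`; NO `c₀`, NO volume.  (M3) NOT HERE: the backgrounds, [Balaban1985Averaging] Prop. 2, the Lipschitz continuity of `U ↦ Ū`.
HONEST SCOPE.  [folklore] `ℓ²` telescoping of landed one-step letters; ONE route sub-step's letter (S3 at `k` levels, two backgrounds) in abstract form;
«NE9 ⇐ the named binders»; NE9 NOT PRINTED ∕ NOT PROVED; NOT summit progress (cell pub-balaban: row NE9 WALLED ON A MODEL; spine PROVED 0∕9; rung (B)+1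
on a finite T⁴ — NOT infinite volume, NOT mass gap, NOT BetaPertH, NOT Clay; HONEST DEPENDENCY: continuum YM on T⁴ ⇐ BetaPertH ∧ nine spine estimates
(0/9 proved); BetaPertH ⇐ (D1) ∧ (D4) ∧ CAP+tail; G-an2-4 gates asym, D1 and NE2/3/4).  NEW file importing `B9Eq319QprimeTowerLipschitzL2` +
`B9Eq319QprimeLipschitzTwoBackgrounds` only; nothing modified.  Net new unproved facts: 0.
-/

noncomputable section

open scoped BigOperators

namespace Literature.MathematicalPhysics.QuantumFieldTheory.Balaban1983to89.B9Eq319QprimeTowerLipschitzL2TwoBackgrounds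

open B4Sect5Torus (TSite)
open B9SectCLatticeCarrier (Bond)
open B9Eq319QprimeTorus (fineP QprimeLin)
open B9Eq319QprimeLipschitz (rho_nonneg)
open B9Eq319QprimeLipschitzTwoBackgrounds (sum_norm_sq_QprimeLin_sub_QprimeLin_le rho₂_nonneg)
open B9Eq319QprimeTowerLipschitzL2 (sum_norm_sq_QprimeLin_flat_le sqrt_sum_norm_sq_QprimeTower_flat_le sqrt_sum_norm_sq_QprimeTower_sub_id_le)
open B9Eq315QTower (towerP QprimeTower)

variable {d : ℕ} (L : ℕ) [NeZero L]

/-! ## §0 Minkowski in `ℓ²` (finite families) -/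

omit [NeZero L] in
/-- `√(Σ ‖x_b + y_b‖²) ≤ √(Σ ‖x_b‖²) + √(Σ ‖y_b‖²)`. [folklore] -/
private theorem sqrt_sum_norm_add_sq_le {ι : Type*} [Fintype ι] {E : Type*} [SeminormedAddCommGroup E] (x y : ι → E) :
    Real.sqrt (∑ b, ‖x b + y b‖ ^ 2) ≤ Real.sqrt (∑ b, ‖x b‖ ^ 2) + Real.sqrt (∑ b, ‖y b‖ ^ 2) := by
  have hX : 0 ≤ Real.sqrt (∑ b, ‖x b‖ ^ 2) := Real.sqrt_nonneg _
  have hY : 0 ≤ Real.sqrt (∑ b, ‖y b‖ ^ 2) := Real.sqrt_nonneg _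
  have hcs : ∑ b, ‖x b‖ * ‖y b‖ ≤ Real.sqrt (∑ b, ‖x b‖ ^ 2) * Real.sqrt (∑ b, ‖y b‖ ^ 2) := Real.sum_mul_le_sqrt_mul_sqrt _ _ _
  rw [Real.sqrt_le_left (by positivity)]
  calc ∑ b, ‖x b + y b‖ ^ 2 ≤ ∑ b, (‖x b‖ + ‖y b‖) ^ 2 :=
        Finset.sum_le_sum fun b _ => pow_le_pow_left₀ (norm_nonneg _) (norm_add_le _ _) 2
    _ = ∑ b, ‖x b‖ ^ 2 + 2 * ∑ b, ‖x b‖ * ‖y b‖ + ∑ b, ‖y b‖ ^ 2 := by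
        rw [Finset.mul_sum, ← Finset.sum_add_distrib, ← Finset.sum_add_distrib]
        exact Finset.sum_congr rfl fun b _ => by ring
    _ ≤ ∑ b, ‖x b‖ ^ 2 + 2 * (Real.sqrt (∑ b, ‖x b‖ ^ 2) * Real.sqrt (∑ b, ‖y b‖ ^ 2)) + ∑ b, ‖y b‖ ^ 2 := by linarith
    _ = (Real.sqrt (∑ b, ‖x b‖ ^ 2) + Real.sqrt (∑ b, ‖y b‖ ^ 2)) ^ 2 := by
        rw [add_sq, Real.sq_sqrt (by positivity), Real.sq_sqrt (by positivity)]; ring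

omit [NeZero L] in
/-- `√Σ‖x‖² ≤ √Σ‖y‖² + √Σ‖x − y‖²`. [folklore] -/
private theorem sqrt_sum_norm_sq_le_add_sub {ι : Type*} [Fintype ι] {E : Type*} [SeminormedAddCommGroup E] (x y : ι → E) :
    Real.sqrt (∑ b, ‖x b‖ ^ 2) ≤ Real.sqrt (∑ b, ‖y b‖ ^ 2) + Real.sqrt (∑ b, ‖x b - y b‖ ^ 2) := by
  have h := sqrt_sum_norm_add_sq_le y (fun b => x b - y b)
  simp only [add_sub_cancel] at h
  exact h

/-! ## §1 The two-family `ℓ²` telescoping along the tower: `D_n ≤ P_n·(T_n − 1)` -/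

section Tower

variable (m : Fin d → ℕ) [∀ i, NeZero (m i)] {V : Type*} [NormedAddCommGroup V] [NormedSpace ℂ V]

omit [∀ i, NeZero (m i)] in
/-- **ONE LEVEL FAMILY: `Q′_n(R)` IS `ℓ²`-BOUNDED BY `P_n·(√(L^{−d}))^n`**, `P_n = Π_{j<n}(1 + ρ(ε_j))` — leaf-02's flat contraction
`sqrt_sum_norm_sq_QprimeTower_flat_le` plus the deviation `sqrt_sum_norm_sq_QprimeTower_sub_id_le` (Minkowski).
[cite: Balaban1985BackgroundPropagators, (3.19) p.393, p.403, (3.79)–(3.81) p.406; Balaban1985Averaging, (2)–(4) pp.17–18] -/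
theorem sqrt_sum_norm_sq_QprimeTower_le (Rlev : (n : ℕ) → Bond d (towerP L m (n + 1)) → V →ₗ[ℂ] V) (ε : ℕ → ℝ) (hε : ∀ n, 0 ≤ ε n)
    (hR : ∀ n b v, ‖Rlev n b v - v‖ ≤ ε n * ‖v‖) (n : ℕ) (l : TSite d (towerP L m n) → V) :
    Real.sqrt (∑ y : TSite d m, ‖QprimeTower L m Rlev n l y‖ ^ 2) ≤
      (∏ j ∈ Finset.range n, (1 + ((1 + ε j) ^ (d * (L - 1)) - 1))) *
        ((Real.sqrt (((L : ℝ) ^ d)⁻¹)) ^ n * Real.sqrt (∑ x : TSite d (towerP L m n), ‖l x‖ ^ 2)) := by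
  have hflat := sqrt_sum_norm_sq_QprimeTower_flat_le L m n l
  have hdev := sqrt_sum_norm_sq_QprimeTower_sub_id_le L m Rlev ε hε hR n l
  have hmink := sqrt_sum_norm_sq_le_add_sub (fun y => QprimeTower L m Rlev n l y)
    (fun y => QprimeTower L m (fun _ _ => (LinearMap.id : V →ₗ[ℂ] V)) n l y)
  have h0 : 0 ≤ (Real.sqrt (((L : ℝ) ^ d)⁻¹)) ^ n * Real.sqrt (∑ x : TSite d (towerP L m n), ‖l x‖ ^ 2) := by positivity
  calc Real.sqrt (∑ y : TSite d m, ‖QprimeTower L m Rlev n l y‖ ^ 2)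
      ≤ (Real.sqrt (((L : ℝ) ^ d)⁻¹)) ^ n * Real.sqrt (∑ x : TSite d (towerP L m n), ‖l x‖ ^ 2) +
          ((∏ j ∈ Finset.range n, (1 + ((1 + ε j) ^ (d * (L - 1)) - 1))) - 1) *
            ((Real.sqrt (((L : ℝ) ^ d)⁻¹)) ^ n * Real.sqrt (∑ x : TSite d (towerP L m n), ‖l x‖ ^ 2)) := hmink.trans (add_le_add hflat hdev)
    _ = _ := by ring

omit [∀ i, NeZero (m i)] in
/-- **THE TWO-FAMILY TOWER LETTER IN `ℓ²`, VOLUME-FREE**: for two level families `R`, `R′` of `ℂ`-linear bond transporters, at every level `j` both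
`ε_j`-close to the identity and `δ_j`-close to each other,
`√(Σ_y ‖(Q′_n(R)λ − Q′_n(R′)λ)(y)‖²) ≤ Π_{j<n}(1+ρ(ε_j))·(Π_{j<n}(1+ρ₂(ε_j,δ_j)) − 1)·(√(L^{−d}))^n·√(Σ_x ‖λ(x)‖²)`, `ρ(ε) = (1+ε)^{d(L−1)} − 1`,
`ρ₂(ε,δ) = d(L−1)·δ·(1+ε)^{d(L−1)}` — the telescoping `Q′_{n+1}(R) − Q′_{n+1}(R′) = [Q′_n(R) − Q′_n(R′)]∘Q′(R_n) + Q′_n(R′)∘[Q′(R_n) − Q′(R′_n)]` in `ℓ²`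
(Minkowski) with ne9-leaf-03's one-step two-background Hilbert letter, leaf-02's one-family letters and `sqrt_sum_norm_sq_QprimeTower_le`; the recursion
`D_{n+1} ≤ D_n(1+ρ_n) + P_nρ₂,ₙ` is closed by `D_n ≤ P_n(T_n − 1)` because `ρ₂,ₙ ≤ (1+ρ_n)T_nρ₂,ₙ`.
[cite: Balaban1985BackgroundPropagators, (3.19) p.393, (3.35)–(3.37) p.396, (3.65) p.403, (3.79)–(3.81) p.406; Balaban1985Averaging, (2)–(4) pp.17–18] -/
theorem sqrt_sum_norm_sq_QprimeTower_sub_QprimeTower_le (Rlev Rlev' : (n : ℕ) → Bond d (towerP L m (n + 1)) → V →ₗ[ℂ] V) (ε δ : ℕ → ℝ)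
    (hε : ∀ n, 0 ≤ ε n) (hδ : ∀ n, 0 ≤ δ n) (hR : ∀ n b v, ‖Rlev n b v - v‖ ≤ ε n * ‖v‖) (hR' : ∀ n b v, ‖Rlev' n b v - v‖ ≤ ε n * ‖v‖)
    (hRR' : ∀ n b v, ‖Rlev n b v - Rlev' n b v‖ ≤ δ n * ‖v‖) :
    ∀ (n : ℕ) (l : TSite d (towerP L m n) → V),
      Real.sqrt (∑ y : TSite d m, ‖QprimeTower L m Rlev n l y - QprimeTower L m Rlev' n l y‖ ^ 2) ≤
        (∏ j ∈ Finset.range n, (1 + ((1 + ε j) ^ (d * (L - 1)) - 1))) *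
          ((∏ j ∈ Finset.range n, (1 + (d * (L - 1) : ℕ) * δ j * (1 + ε j) ^ (d * (L - 1)))) - 1) *
          ((Real.sqrt (((L : ℝ) ^ d)⁻¹)) ^ n * Real.sqrt (∑ x : TSite d (towerP L m n), ‖l x‖ ^ 2))
  | 0, l => by simp
  | n + 1, l => by
    set θ : ℕ → ℝ := fun j => (1 + ε j) ^ (d * (L - 1)) - 1 with hθ
    have hθ0 : ∀ j, 0 ≤ θ j := fun j => by rw [hθ]; exact rho_nonneg L (d := d) (hε j)
    set θ₂ : ℕ → ℝ := fun j => (d * (L - 1) : ℕ) * δ j * (1 + ε j) ^ (d * (L - 1)) with hθ₂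
    have hθ₂0 : ∀ j, 0 ≤ θ₂ j := fun j => by rw [hθ₂]; exact rho₂_nonneg L (d := d) (hε j) (hδ j)
    set ρ : ℝ := Real.sqrt (((L : ℝ) ^ d)⁻¹) with hρ
    have hρ0 : 0 ≤ ρ := Real.sqrt_nonneg _
    set P : ℝ := ∏ j ∈ Finset.range n, (1 + θ j) with hP
    set T : ℝ := ∏ j ∈ Finset.range n, (1 + θ₂ j) with hT
    have hP1 : 1 ≤ P := Finset.one_le_prod (s := Finset.range n) fun j _ => by linarith [hθ0 j]
    have hT1 : 1 ≤ T := Finset.one_le_prod (s := Finset.range n) fun j _ => by linarith [hθ₂0 j]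
    -- the two level-`n` images and the recursion `Q′_{n+1} = Q′_n ∘ Q′(level n)` (definitional)
    set x : TSite d (towerP L m n) → V := QprimeLin L (towerP L m n) (Rlev n) l with hx
    set x' : TSite d (towerP L m n) → V := QprimeLin L (towerP L m n) (Rlev' n) l with hx'
    set y : TSite d (towerP L m n) → V :=
      QprimeLin L (towerP L m n) (fun _ : Bond d (fineP L (towerP L m n)) => (LinearMap.id : V →ₗ[ℂ] V)) l with hy
    set S : ℝ := Real.sqrt (∑ b, ‖l b‖ ^ 2) with hS
    have hS0 : 0 ≤ S := Real.sqrt_nonneg _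
    have hflat : Real.sqrt (∑ b, ‖y b‖ ^ 2) ≤ ρ * S := by
      calc Real.sqrt (∑ b, ‖y b‖ ^ 2) ≤ Real.sqrt (((L : ℝ) ^ d)⁻¹ * ∑ b, ‖l b‖ ^ 2) :=
            Real.sqrt_le_sqrt (sum_norm_sq_QprimeLin_flat_le L (towerP L m n) l)
        _ = ρ * S := Real.sqrt_mul (by positivity) _
    have hdev : Real.sqrt (∑ b, ‖x b - y b‖ ^ 2) ≤ θ n * (ρ * S) := by
      have h := B9Eq319QprimeLipschitz.sum_norm_sq_QprimeLin_sub_flat_le L (towerP L m n) (Rlev n) (hε n) (hR n) l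
      calc Real.sqrt (∑ b, ‖x b - y b‖ ^ 2) ≤ Real.sqrt (θ n ^ 2 * (((L : ℝ) ^ d)⁻¹ * ∑ b, ‖l b‖ ^ 2)) := Real.sqrt_le_sqrt h
        _ = θ n * (ρ * S) := by
            rw [Real.sqrt_mul' _ (by positivity), Real.sqrt_sq (hθ0 n), Real.sqrt_mul (by positivity)]
    have hxy : Real.sqrt (∑ b, ‖x b‖ ^ 2) ≤ (1 + θ n) * (ρ * S) := by
      have h := sqrt_sum_norm_sq_le_add_sub x y
      nlinarith [hflat, hdev]
    -- the one-step two-background Hilbert letter at level `n`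
    have hxx' : Real.sqrt (∑ b, ‖x b - x' b‖ ^ 2) ≤ θ₂ n * (ρ * S) := by
      have h := sum_norm_sq_QprimeLin_sub_QprimeLin_le L (towerP L m n) (Rlev n) (Rlev' n) (hε n) (hδ n) (hR n) (hR' n) (hRR' n) l
      calc Real.sqrt (∑ b, ‖x b - x' b‖ ^ 2) ≤ Real.sqrt (θ₂ n ^ 2 * (((L : ℝ) ^ d)⁻¹ * ∑ b, ‖l b‖ ^ 2)) := Real.sqrt_le_sqrt h
        _ = θ₂ n * (ρ * S) := by
            rw [Real.sqrt_mul' _ (by positivity), Real.sqrt_sq (hθ₂0 n), Real.sqrt_mul (by positivity)]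
    have ih := sqrt_sum_norm_sq_QprimeTower_sub_QprimeTower_le Rlev Rlev' ε δ hε hδ hR hR' hRR' n x
    have hbd := sqrt_sum_norm_sq_QprimeTower_le L m Rlev' ε hε hR' n (x - x')
    have hsplit : ∀ c, QprimeTower L m Rlev (n + 1) l c - QprimeTower L m Rlev' (n + 1) l c =
        (QprimeTower L m Rlev n x c - QprimeTower L m Rlev' n x c) + QprimeTower L m Rlev' n (x - x') c := by
      intro c
      have e1 : QprimeTower L m Rlev (n + 1) l c = QprimeTower L m Rlev n x c := rfl
      have e2 : QprimeTower L m Rlev' (n + 1) l c = QprimeTower L m Rlev' n x' c := rfl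
      rw [e1, e2, map_sub, Pi.sub_apply]
      abel
    have key : θ₂ n ≤ (1 + θ n) * T * θ₂ n := by
      have h1 : 1 ≤ (1 + θ n) * T := by nlinarith [hθ0 n, hT1]
      nlinarith [hθ₂0 n, h1]
    calc Real.sqrt (∑ c : TSite d m, ‖QprimeTower L m Rlev (n + 1) l c - QprimeTower L m Rlev' (n + 1) l c‖ ^ 2)
        = Real.sqrt (∑ c : TSite d m, ‖(QprimeTower L m Rlev n x c - QprimeTower L m Rlev' n x c) +
            QprimeTower L m Rlev' n (x - x') c‖ ^ 2) := by
          congr 1; exact Finset.sum_congr rfl fun c _ => by rw [hsplit c]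
      _ ≤ Real.sqrt (∑ c : TSite d m, ‖QprimeTower L m Rlev n x c - QprimeTower L m Rlev' n x c‖ ^ 2) +
          Real.sqrt (∑ c : TSite d m, ‖QprimeTower L m Rlev' n (x - x') c‖ ^ 2) := sqrt_sum_norm_add_sq_le _ _
      _ ≤ P * (T - 1) * (ρ ^ n * Real.sqrt (∑ b, ‖x b‖ ^ 2)) + P * (ρ ^ n * Real.sqrt (∑ b, ‖(x - x') b‖ ^ 2)) := add_le_add ih hbd
      _ ≤ P * (T - 1) * (ρ ^ n * ((1 + θ n) * (ρ * S))) + P * (ρ ^ n * (θ₂ n * (ρ * S))) := by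
          have hPT : 0 ≤ P * (T - 1) := by nlinarith
          have h2 : Real.sqrt (∑ b, ‖(x - x') b‖ ^ 2) ≤ θ₂ n * (ρ * S) := by simpa only [Pi.sub_apply] using hxx'
          gcongr
      _ = P * ((T - 1) * (1 + θ n) + θ₂ n) * (ρ ^ (n + 1) * S) := by rw [pow_succ]; ring
      _ ≤ P * ((1 + θ n) * (T * (1 + θ₂ n) - 1)) * (ρ ^ (n + 1) * S) := by
          have hPr : 0 ≤ P := by linarith
          have hρS : 0 ≤ ρ ^ (n + 1) * S := by positivity
          have hmid : (T - 1) * (1 + θ n) + θ₂ n ≤ (1 + θ n) * (T * (1 + θ₂ n) - 1) := by nlinarith [key]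
          exact mul_le_mul_of_nonneg_right (mul_le_mul_of_nonneg_left hmid hPr) hρS
      _ = ((∏ j ∈ Finset.range (n + 1), (1 + θ j)) * ((∏ j ∈ Finset.range (n + 1), (1 + θ₂ j)) - 1)) * (ρ ^ (n + 1) * S) := by
          rw [Finset.prod_range_succ, Finset.prod_range_succ, hP, hT]; ring

end Tower

end Literature.MathematicalPhysics.QuantumFieldTheory.Balaban1983to89.B9Eq319QprimeTowerLipschitzL2TwoBackgrounds

end
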